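/-
Copyright (c) 2026 the pub-hodgecm-mathlib formalisation cell (harness21).  Prover seat hodgecm-mathlib-K2E1-p08 (g4), Track B ∕ K2-LIT, h413 =
`stmt-HodgeConjecture-24833`, line `K2_E1_TraceFormulaBeta`, campaign «RES-RANK-ONE»; DEAL of the dealer K2E1-plan (g2) 2026-09-04T02:44:20Z (group side of (H4-prep)),
companion of `K2E1BorelLeviU`: the `𝓕`-FREE forms — a fundamental domain of finite measure of the rational lattice of the radical EXISTS in the route's currency
(`cmParabolicData L 2`, `cmParabolicDataR L 3`), so the modulus-one statements hold for every Haar measure outright.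
-/
import Summits.HodgeConjecture.HodgeConjecture.Theorems.K2E1BorelLeviU      -- ★ (this seat): `measurePreserving_conj_cmParabolicData_two` ∕ `…R_three` (given a fundamental domain)
import HarnessLib

/-!
# K2·E1 — `K2E1BorelLeviUDomains`: FUNDAMENTAL DOMAINS OF FINITE MEASURE FOR THE RATIONAL LATTICES OF THE RADICALS OF `U(Φ₂)`, `U(Φ₃)` (route currency),
# AND THE `𝓕`-FREE MODULUS-ONE STATEMENTS

Track B ∕ K2-LIT, crux h413 = `stmt-HodgeConjecture-24833`, route of record `HCCMUnconditional`; cell `hodgecm-mathlib`, squad K2, ENGINE E1.  Prover seat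
`hodgecm-mathlib-K2E1-p08` (g4); DEAL of the dealer K2E1-plan (g2) 2026-09-04T02:44:20Z, companion of ★ `K2E1BorelLeviU`.  THEOREMS ONLY (no `def`, no `instance`, no
notation, no named-fact hypothesis, no `sorry`); lane `--supports stmt-HodgeConjecture-24833 --as helper` (count-neutral).  Closes no socket.

WHAT.  The tree holds Tate's fundamental domains for the rational points of the Borel radical of Mok's `U(J_N)`: `n(𝓕⁻)` for the line `N(𝔸_F) ≅ 𝔸_E⁻` of `U(J₂)` (★
`UnitaryGroupLineUnipotentTwo.isFundamentalDomain_image_traceZeroFundamentalDomain_two`, `measure_image_traceZeroFundamentalDomain_lt_top_two`) and `𝓕_N = heisChart(D_E × 𝓕⁻)` for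
the Heisenberg group of `U(J₃)` (★ `UnitaryGroupHeisenbergFundamentalDomain.isFundamentalDomain_heisFundamentalDomain`, `exists_isCompact_heisFundamentalDomain_subset`), both on the
carrier `adelicUnipotent F E c N` with the lattice `rationalUnipotent = G(F) ∩ N(𝔸_F)`.  This file transports them to the route's spelling — the radicals `(cmParabolicData L 2).radical`
(`= val⁻¹(1 + 𝔫_1)`, ★ p855325) and `(cmParabolicDataR L 3).radical` (`= val⁻¹(R_u(P_{(1,1,1)}))`, ★ p855423) over the literal form `Φ_N` — by the two-step `subst` device of ★
p855771 §2 (first `Nsub = adelicUnipotent` for any EQUAL subgroup, the measurable structure passed implicitly so that it substitutes too; then `J = (StdForm.antidiagonal N).over L` for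
any EQUAL form, ★ `antidiagOne_eq_over`; ★ `upperUnitriangular_eq_standardUnipotentRadical_two` ∕ ★ `upperUnitriangular_eq_flagUnipotentRadical_three` identify the radicals):
* `exists_isFundamentalDomain_cmParabolicData_two`, `exists_isFundamentalDomain_cmParabolicDataR_three` — **a measurable fundamental domain of `N(L⁺)` in `N(𝔸_{L⁺})` of finite
  measure EXISTS** for every measure finite on compacta (so the constant-term functional `CT_𝓕` of ★ `K2E1ResidualConstantTermFunctional` ∕ ★ `K2E1ConstantTermTorusU` is never
  vacuously quantified);
* `measurePreserving_conj_cmParabolicData_two'`, `measurePreserving_conj_cmParabolicDataR_three'` — **MODULUS ONE ON `B(L⁺)`, `𝓕`-FREE**: for every Haar measure `ν_N` on the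
  radical and every rational upper-triangular `γ ∈ U(Φ_N)(𝔸_{L⁺})`, `u ↦ γuγ⁻¹` preserves `ν_N` (★ `K2E1BorelLeviU` given the domain above).
HONEST LABEL: HC_CM is proved only modulo the 7 printed citations (2 remaining named inputs: hLiu418 = `stmt-HodgeConjecture-24832`, h413 =
`stmt-HodgeConjecture-24833`) until rung 0 closes; this file asserts no named fact and closes no socket.
References: [CasselsFrohlichANT1967] J. W. S. Cassels, A. Fröhlich (eds.), *Algebraic Number Theory* (1967), Ch. XV Thm. 4.1.3 (Tate) · [Rogawski1990] J. D. Rogawski,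
*Automorphic Representations of Unitary Groups in Three Variables* (1990), §1.10 p. 9, §2.1 · [MoeglinWaldspurger1995] I.2.6 · [Raghunathan1972] Ch. I Remark 1.9 ·
[BorelJacquet1979] §4.4.
-/

set_option autoImplicit false
-- the mandated namespace repeats the single-problem summit's segment (`HodgeConjecture.HodgeConjecture`)
set_option linter.dupNamespace false

noncomputable section

open MeasureTheory Measure Set Topology NumberField IsDedekindDomain
open scoped ENNReal Pointwise MatrixGroups
open Literature.NumberTheory.Automorphic Literature.NumberTheory.Automorphic.UnitaryGroup AdelicGroupData
open Summit.HodgeConjecture.HodgeConjecture.Cruxes.H413.K2E1CuspidalSpectrumUnitary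
  (cmUnipotentRadical cmParabolicData cmUnipotentRadicalR cmParabolicDataR flagUnipotentRadical)
open Summit.HodgeConjecture.HodgeConjecture.Cruxes.H413.K2E1SiegelRadicalCocompactU2 (upperUnitriangular_eq_standardUnipotentRadical_two)
open Summit.HodgeConjecture.HodgeConjecture.Cruxes.H413.K2E1HeisenbergRadicalCocompactU3 (upperUnitriangular_eq_flagUnipotentRadical_three)
open Summit.HodgeConjecture.HodgeConjecture.Cruxes.H413.K2E1BorelLeviU

namespace Summit.HodgeConjecture.HodgeConjecture.Cruxes.H413.K2E1BorelLeviUDomains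

/-! ## §1 Mok's currency: for every subgroup EQUAL to `adelicUnipotent F E c N`, `N = 2, 3` -/

section QuasiSplit

variable {F E : Type} [Field F] [NumberField F] [Field E] [NumberField E] [Algebra F E] {c : E ≃ₐ[F] E}

/-- `N = 2`: for every subgroup `Nsub` EQUAL to the line radical `adelicUnipotent F E c 2` of `U(J₂)` and every measure finite on compacta, a measurable fundamental domain of
`Nsub ∩ G(F)` of finite measure EXISTS (Tate's `n(𝓕⁻)`, ★ `isFundamentalDomain_image_traceZeroFundamentalDomain_two`, ★ `measure_image_traceZeroFundamentalDomain_lt_top_two`); the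
measurable structure is an implicit binder so that the statement transports along `Nsub = …` by `subst`. [cite: CasselsFrohlichANT1967, Ch. XV Thm. 4.1.3] [cite: Rogawski1990, §2.1] -/
theorem exists_isFundamentalDomain_of_eq_two (hc : c * c = 1) {Nsub : Subgroup (quasiSplit F E c 2).Adelic} (hN : Nsub = adelicUnipotent F E c 2)
    {mN : MeasurableSpace ↥Nsub} (hBorel : BorelSpace ↥Nsub) (ν : Measure ↥Nsub) (hν : IsFiniteMeasureOnCompacts ν) :
    ∃ 𝓕 : Set ↥Nsub, IsFundamentalDomain ↥(((quasiSplit F E c 2).arithmeticSubgroup).comap Nsub.subtype) 𝓕 ν ∧ ν 𝓕 < ⊤ := by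
  subst hN
  borelize (AdeleRing (𝓞 E) E)
  exact ⟨_, isFundamentalDomain_image_traceZeroFundamentalDomain_two (F := F) (E := E) (c := c) (by decide) (by decide) hc ν,
    measure_image_traceZeroFundamentalDomain_lt_top_two (F := F) (E := E) (c := c) (by decide) (by decide) hc ν⟩

/-- `N = 3`: for every subgroup `Nsub` EQUAL to the Heisenberg radical `adelicUnipotent F E c 3` of `U(J₃)` and every measure finite on compacta, a measurable fundamental domain
of `Nsub ∩ G(F)` of finite measure EXISTS (Tate's `𝓕_N = heisChart(D_E × 𝓕⁻)`, ★ `isFundamentalDomain_heisFundamentalDomain`, ★ `exists_isCompact_heisFundamentalDomain_subset`).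
[cite: CasselsFrohlichANT1967, Ch. XV Thm. 4.1.3] [cite: Rogawski1990, §2.1] -/
theorem exists_isFundamentalDomain_of_eq_three (hc : c * c = 1) {Nsub : Subgroup (quasiSplit F E c 3).Adelic} (hN : Nsub = adelicUnipotent F E c 3)
    {mN : MeasurableSpace ↥Nsub} (hBorel : BorelSpace ↥Nsub) (ν : Measure ↥Nsub) (hν : IsFiniteMeasureOnCompacts ν) :
    ∃ 𝓕 : Set ↥Nsub, IsFundamentalDomain ↥(((quasiSplit F E c 3).arithmeticSubgroup).comap Nsub.subtype) 𝓕 ν ∧ ν 𝓕 < ⊤ := by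
  subst hN
  borelize (AdeleRing (𝓞 E) E)
  obtain ⟨C, hC, hsub⟩ := exists_isCompact_heisFundamentalDomain_subset (F := F) (E := E) (c := c) hc
  exact ⟨_, isFundamentalDomain_heisFundamentalDomain hc ν, (measure_mono hsub).trans_lt hC.measure_lt_top⟩

end QuasiSplit

/-! ## §2 The route's currency: `J` ANY form equal to `(StdForm.antidiagonal N).over L`, then the literal `Φ_N` and `cmParabolicData L 2` ∕ `cmParabolicDataR L 3` -/

section CM

variable (L : Type) [Field L] [NumberField L] [IsCMField L]

/-- `N = 2`, for the Siegel radical `U(J) ∩ (1 + 𝔫_1)` of `U(J)`, `J` ANY matrix equal to `(StdForm.antidiagonal 2).over L` (the route's `Φ₂` by ★ `antidiagOne_eq_over`): §1 transported along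
`J = J'` by substitution (★ `upperUnitriangular_eq_standardUnipotentRadical_two`). [cite: CasselsFrohlichANT1967, Ch. XV Thm. 4.1.3] [cite: BorelJacquet1979, §4.4] -/
theorem exists_isFundamentalDomain_siegel {J : Matrix (Fin 2) (Fin 2) L} (hJ : (StdForm.antidiagonal 2).over L = J)
    {mN : MeasurableSpace ↥((standardUnipotentRadical 2 1 (AdeleRing (𝓞 L) L)).comap (adelicVal (↥(maximalRealSubfield L)) L (IsCMField.complexConj L) 2 J))}
    (hBorel : BorelSpace ↥((standardUnipotentRadical 2 1 (AdeleRing (𝓞 L) L)).comap (adelicVal (↥(maximalRealSubfield L)) L (IsCMField.complexConj L) 2 J)))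
    (ν : Measure ↥((standardUnipotentRadical 2 1 (AdeleRing (𝓞 L) L)).comap (adelicVal (↥(maximalRealSubfield L)) L (IsCMField.complexConj L) 2 J)))
    (hν : IsFiniteMeasureOnCompacts ν) :
    ∃ 𝓕, IsFundamentalDomain ↥(((adelicGroupData (↥(maximalRealSubfield L)) L (IsCMField.complexConj L) 2 J).arithmeticSubgroup).comap
        ((standardUnipotentRadical 2 1 (AdeleRing (𝓞 L) L)).comap (adelicVal (↥(maximalRealSubfield L)) L (IsCMField.complexConj L) 2 J)).subtype) 𝓕 ν ∧ ν 𝓕 < ⊤ := by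
  subst hJ
  exact exists_isFundamentalDomain_of_eq_two (by rw [← pow_two, ← IsCMField.orderOf_complexConj L, pow_orderOf_eq_one])
    (congrArg (Subgroup.comap (adelicVal (↥(maximalRealSubfield L)) L (IsCMField.complexConj L) 2 ((StdForm.antidiagonal 2).over L)))
      (upperUnitriangular_eq_standardUnipotentRadical_two (AdeleRing (𝓞 L) L)).symm) hBorel ν hν

/-- `N = 3`, for the Heisenberg radical `U(J) ∩ R_u(P_{(1,1,1)})` of `U(J)`, `J` ANY matrix equal to `(StdForm.antidiagonal 3).over L` (the route's `Φ₃` by ★ `antidiagOne_eq_over`): §1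
transported along `J = J'` by substitution (★ `upperUnitriangular_eq_flagUnipotentRadical_three`). [cite: CasselsFrohlichANT1967, Ch. XV Thm. 4.1.3] [cite: BorelJacquet1979, §4.4] -/
theorem exists_isFundamentalDomain_heisenberg {J : Matrix (Fin 3) (Fin 3) L} (hJ : (StdForm.antidiagonal 3).over L = J)
    {mN : MeasurableSpace ↥((flagUnipotentRadical 3 1 (AdeleRing (𝓞 L) L)).comap (adelicVal (↥(maximalRealSubfield L)) L (IsCMField.complexConj L) 3 J))}
    (hBorel : BorelSpace ↥((flagUnipotentRadical 3 1 (AdeleRing (𝓞 L) L)).comap (adelicVal (↥(maximalRealSubfield L)) L (IsCMField.complexConj L) 3 J)))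
    (ν : Measure ↥((flagUnipotentRadical 3 1 (AdeleRing (𝓞 L) L)).comap (adelicVal (↥(maximalRealSubfield L)) L (IsCMField.complexConj L) 3 J)))
    (hν : IsFiniteMeasureOnCompacts ν) :
    ∃ 𝓕, IsFundamentalDomain ↥(((adelicGroupData (↥(maximalRealSubfield L)) L (IsCMField.complexConj L) 3 J).arithmeticSubgroup).comap
        ((flagUnipotentRadical 3 1 (AdeleRing (𝓞 L) L)).comap (adelicVal (↥(maximalRealSubfield L)) L (IsCMField.complexConj L) 3 J)).subtype) 𝓕 ν ∧ ν 𝓕 < ⊤ := by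
  subst hJ
  exact exists_isFundamentalDomain_of_eq_three (by rw [← pow_two, ← IsCMField.orderOf_complexConj L, pow_orderOf_eq_one])
    (congrArg (Subgroup.comap (adelicVal (↥(maximalRealSubfield L)) L (IsCMField.complexConj L) 3 ((StdForm.antidiagonal 3).over L)))
      (upperUnitriangular_eq_flagUnipotentRadical_three (AdeleRing (𝓞 L) L)).symm) hBorel ν hν

/-- **`N = 2`: A FUNDAMENTAL DOMAIN OF FINITE MEASURE OF THE LATTICE `N(L⁺) ⊂ N(𝔸_{L⁺})` (Siegel radical of `U(Φ₂)`) EXISTS** in the route's currency `cmParabolicData L 2`, for every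
measure finite on compacta. [cite: CasselsFrohlichANT1967, Ch. XV Thm. 4.1.3] [cite: Rogawski1990, §2.1] -/
theorem exists_isFundamentalDomain_cmParabolicData_two (i : (cmParabolicData L 2).ι)
    [MeasurableSpace ((cmParabolicData L 2).radical i)] [hBorel : BorelSpace ((cmParabolicData L 2).radical i)]
    (νN : Measure ((cmParabolicData L 2).radical i)) [hfin : IsFiniteMeasureOnCompacts νN] :
    ∃ 𝓕 : Set ((cmParabolicData L 2).radical i), IsFundamentalDomain ((cmParabolicData L 2).rational i) 𝓕 νN ∧ νN 𝓕 < ⊤ := by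
  obtain ⟨k, hk⟩ := i
  obtain rfl : k = 1 := by omega
  exact exists_isFundamentalDomain_siegel L (antidiagOne_eq_over (L := L) (N := 2)).symm hBorel νN hfin

/-- **`N = 3`: A FUNDAMENTAL DOMAIN OF FINITE MEASURE OF THE HEISENBERG LATTICE `N(L⁺) ⊂ N(𝔸_{L⁺})` (radical of record of `U(Φ₃)`) EXISTS** in the route's currency `cmParabolicDataR L 3`,
for every measure finite on compacta. [cite: CasselsFrohlichANT1967, Ch. XV Thm. 4.1.3] [cite: Rogawski1990, §2.1] -/
theorem exists_isFundamentalDomain_cmParabolicDataR_three (i : (cmParabolicDataR L 3).ι)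
    [MeasurableSpace ((cmParabolicDataR L 3).radical i)] [hBorel : BorelSpace ((cmParabolicDataR L 3).radical i)]
    (νN : Measure ((cmParabolicDataR L 3).radical i)) [hfin : IsFiniteMeasureOnCompacts νN] :
    ∃ 𝓕 : Set ((cmParabolicDataR L 3).radical i), IsFundamentalDomain ((cmParabolicDataR L 3).rational i) 𝓕 νN ∧ νN 𝓕 < ⊤ := by
  obtain ⟨k, hk⟩ := i
  obtain rfl : k = 1 := by omega
  exact exists_isFundamentalDomain_heisenberg L (antidiagOne_eq_over (L := L) (N := 3)).symm hBorel νN hfin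

/-! ## §3 The `𝓕`-free modulus-one statements -/

/-- **MODULUS ONE ON `B(L⁺)` FOR `U(Φ₂)`, `𝓕`-FREE**: for every Haar measure `ν_N` on the Siegel radical and every rational upper-triangular `γ ∈ U(Φ₂)(𝔸_{L⁺})`, `u ↦ γuγ⁻¹` preserves `ν_N`
(★ `measurePreserving_conj_cmParabolicData_two` at the domain of §2).  In particular `δ_B(diag(a, ā⁻¹)) = |aā|_𝔸 = 1` for `a ∈ Lˣ`. [cite: MoeglinWaldspurger1995, I.2.6] [cite: Raghunathan1972, Ch. I Remark 1.9] -/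
theorem measurePreserving_conj_cmParabolicData_two' (i : (cmParabolicData L 2).ι)
    [MeasurableSpace ((cmParabolicData L 2).radical i)] [BorelSpace ((cmParabolicData L 2).radical i)]
    (νN : Measure ((cmParabolicData L 2).radical i)) [νN.IsHaarMeasure]
    {γ : (cmDatum L 2 (Matrix.of fun i j : Fin 2 => if i.val + j.val + 1 = 2 then (1 : L) else 0)).Adelic}
    (hγ : γ ∈ (cmDatum L 2 (Matrix.of fun i j : Fin 2 => if i.val + j.val + 1 = 2 then (1 : L) else 0)).arithmeticSubgroup)
    (hB : adelicVal (↥(maximalRealSubfield L)) L (IsCMField.complexConj L) 2 (Matrix.of fun i j : Fin 2 => if i.val + j.val + 1 = 2 then (1 : L) else 0) γ ∈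
      standardParabolicGL (AdeleRing (𝓞 L) L) (id : Fin 2 → Fin 2)) :
    MeasurePreserving (fun u : (cmParabolicData L 2).radical i =>
      (⟨γ * (u : (cmDatum L 2 (Matrix.of fun i j : Fin 2 => if i.val + j.val + 1 = 2 then (1 : L) else 0)).Adelic) * γ⁻¹,
        conj_mem_cmParabolicData_radical_two L i hB u⟩ : (cmParabolicData L 2).radical i)) νN νN := by
  haveI : LocallyCompactSpace ((cmParabolicData L 2).radical i) := (isClosed_cmParabolicData_radical_two L i).locallyCompactSpace
  obtain ⟨𝓕, h𝓕, -⟩ := exists_isFundamentalDomain_cmParabolicData_two L i νN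
  exact measurePreserving_conj_cmParabolicData_two L i νN hγ hB h𝓕

/-- **MODULUS ONE ON `B(L⁺)` FOR `U(Φ₃)`, `𝓕`-FREE**: for every Haar measure `ν_N` on the Heisenberg radical and every rational upper-triangular `γ ∈ U(Φ₃)(𝔸_{L⁺})`, `u ↦ γuγ⁻¹` preserves
`ν_N` (★ `measurePreserving_conj_cmParabolicDataR_three` at the domain of §2).  In particular `δ_B(diag(a, b, ā⁻¹)) = ‖a‖²_{𝔸_L} = 1` for `a ∈ Lˣ`, `b b̄ = 1`.
[cite: MoeglinWaldspurger1995, I.2.6] [cite: Raghunathan1972, Ch. I Remark 1.9] -/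
theorem measurePreserving_conj_cmParabolicDataR_three' (i : (cmParabolicDataR L 3).ι)
    [MeasurableSpace ((cmParabolicDataR L 3).radical i)] [BorelSpace ((cmParabolicDataR L 3).radical i)]
    (νN : Measure ((cmParabolicDataR L 3).radical i)) [νN.IsHaarMeasure]
    {γ : (cmDatum L 3 (Matrix.of fun i j : Fin 3 => if i.val + j.val + 1 = 3 then (1 : L) else 0)).Adelic}
    (hγ : γ ∈ (cmDatum L 3 (Matrix.of fun i j : Fin 3 => if i.val + j.val + 1 = 3 then (1 : L) else 0)).arithmeticSubgroup)
    (hB : adelicVal (↥(maximalRealSubfield L)) L (IsCMField.complexConj L) 3 (Matrix.of fun i j : Fin 3 => if i.val + j.val + 1 = 3 then (1 : L) else 0) γ ∈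
      standardParabolicGL (AdeleRing (𝓞 L) L) (id : Fin 3 → Fin 3)) :
    MeasurePreserving (fun u : (cmParabolicDataR L 3).radical i =>
      (⟨γ * (u : (cmDatum L 3 (Matrix.of fun i j : Fin 3 => if i.val + j.val + 1 = 3 then (1 : L) else 0)).Adelic) * γ⁻¹,
        conj_mem_cmParabolicDataR_radical_three L i hB u⟩ : (cmParabolicDataR L 3).radical i)) νN νN := by
  haveI : LocallyCompactSpace ((cmParabolicDataR L 3).radical i) := (isClosed_cmParabolicDataR_radical_three L i).locallyCompactSpace
  obtain ⟨𝓕, h𝓕, -⟩ := exists_isFundamentalDomain_cmParabolicDataR_three L i νN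
  exact measurePreserving_conj_cmParabolicDataR_three L i νN hγ hB h𝓕

end CM

end Summit.HodgeConjecture.HodgeConjecture.Cruxes.H413.K2E1BorelLeviUDomains

end
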